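import Literature.Topology.FourManifolds.FineRefinement
import Literature.Analysis.Convexity.PLGeneralPosition
import HarnessLib

/-!
# Relative PL approximation of a continuous map on a finite complex (Rushing, Thms. 1.6.10–1.6.11)

The approximation step of the general position arguments of PL topology (T. B. Rushing,
*Topological embeddings* (1973), §1.6.D: the General Position Theorem 1.6.10, Part 1, and the
relative simplicial approximation Theorem 1.6.11; in the proof of the Topological Engulfing
Theorem 4.12.1, Fact 2, it is the passage from `α` to `β`: *"there is a continuous `β` … (3)
`β ∣ α⁻¹(M - W₃) = α ∣ α⁻¹(M - W₃)`, (4) `h_U β ∣ Z` is PL and in general position … it is assumed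
that `β` approximates `α` closely enough"*), for maps of a finite geometric simplicial complex
(Mathlib's `Geometry.SimplicialComplex`) in a finite-dimensional real normed space `W` into a
real normed space `E` (the coordinate space of a chart), with the simplexwise-affine maps
`plMap K g` of vertex data `g` (`Literature.Analysis.Convexity.PLMap`) as PL maps:

* §1 the **PL cutoff** `plMap K (indicator)` of a set of vertices: values in `[0, 1]` on
  `|K|`, `= 1` on the closed simplices spanned inside the set, `= 0` on those spanned outside it
  (`plMap_indicator_mem_Icc`, `plMap_indicator_eq_one`, `plMap_indicator_eq_zero`);
* §2 the **blend** `x ↦ λ x • plMap K g x + (1 - λ x) • f x` of the PL interpolation of vertex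
  data `g` with the map `f` along the cutoff `λ` of a vertex set `A`: continuous on `|K|`, equal to
  `plMap K g` on simplices spanned in `A`, to `f` on simplices spanned off `A`, to `g` at the
  vertices in `A`, and as close to `f` as `plMap K g` is (`exists_plBlend`);
* §3 **relative PL approximation** (`exists_plApprox`): for `f` continuous on `|K|`, a set
  `Z ⊆ W` (where the approximation is to be PL) and `ε > 0` there is a finite refinement `P` of
  `K` such that for EVERY choice of vertex data `g` within `ε / 2` of `f` on the vertices of `P`
  (in the application `g` is chosen afterwards in general position,
  `Literature.Analysis.Convexity.exists_relGenPos_plMap`, keeping the vertices where `f` is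
  already PL fixed) there is `β`, continuous on `|K|`, with `‖β - f‖ ≤ ε` on `|K|`, `β = plMap P g`
  on every closed simplex of `P` spanned by vertices in `Z` (so `β` is PL there, with vertex data
  `g`), `β = f` on every closed simplex of `P` with no vertex in `Z`, and `β v = g v` at the
  vertices of `P` in `Z`.  The refinement comes from `exists_refinement_oscillation_le`
  (`FineRefinement.lean`) and the uniform continuity of `f` on the compact `|K|`; the estimate
  from `norm_plMap_sub_plMap_le` and `norm_plMap_sub_self_le` (`PLGeneralPosition.lean`).

Everything is proved; theorems only (no definition, no named fact).

## References

* T. B. Rushing, *Topological embeddings*, Academic Press (1973), §1.6.D, Thm. 1.6.10 (Part 1)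
  and Thm. 1.6.11; proof of Thm. 4.12.1, Fact 2 (the map `β`). [Rushing1973]
-/

open Set Function Metric Topology

noncomputable section

namespace Literature.Topology.FourManifolds

open Literature.Analysis.Convexity

variable {W : Type*} [NormedAddCommGroup W] [NormedSpace ℝ W] [FiniteDimensional ℝ W]
variable {E : Type*} [NormedAddCommGroup E] [NormedSpace ℝ E]

/-! ### §1 The PL cutoff of a set of vertices -/

section Cutoff

variable {K : Geometry.SimplicialComplex ℝ W} (A : Set W)

/-- The PL cutoff of `A` takes values in `[0, 1]` on `|K|`. [folklore] -/
theorem plMap_indicator_mem_Icc {x : W} (hx : x ∈ K.space) :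
    plMap K (A.indicator fun _ => (1 : ℝ)) x ∈ Icc (0 : ℝ) 1 := by
  classical
  obtain ⟨s, hs, hxs⟩ := Geometry.SimplicialComplex.mem_space_iff.1 hx
  obtain ⟨w, hw0, hw1, hwx⟩ := Finset.mem_convexHull'.1 hxs
  rw [← hwx, plMap_sum_smul hs hw0 hw1]
  constructor
  · exact Finset.sum_nonneg fun v hv => smul_nonneg (hw0 v hv) (indicator_nonneg (fun _ _ => zero_le_one) v)
  · calc ∑ v ∈ s, w v • A.indicator (fun _ => (1 : ℝ)) v ≤ ∑ v ∈ s, w v := by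
          refine Finset.sum_le_sum fun v hv => ?_
          rw [smul_eq_mul]
          exact mul_le_of_le_one_right (hw0 v hv) (indicator_le_self' (fun _ _ => zero_le_one) v)
      _ = 1 := hw1

/-- The PL cutoff of `A` is `1` on a closed simplex spanned by vertices in `A`. [folklore] -/
theorem plMap_indicator_eq_one {s : Finset W} (hs : s ∈ K.faces) (hsA : (s : Set W) ⊆ A) {x : W}
    (hx : x ∈ convexHull ℝ (s : Set W)) : plMap K (A.indicator fun _ => (1 : ℝ)) x = 1 := by
  classical
  obtain ⟨w, hw0, hw1, hwx⟩ := Finset.mem_convexHull'.1 hx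
  rw [← hwx, plMap_sum_smul hs hw0 hw1]
  calc ∑ v ∈ s, w v • A.indicator (fun _ => (1 : ℝ)) v = ∑ v ∈ s, w v := by
        refine Finset.sum_congr rfl fun v hv => ?_
        rw [indicator_of_mem (hsA hv), smul_eq_mul, mul_one]
    _ = 1 := hw1

/-- The PL cutoff of `A` is `0` on a closed simplex spanned by vertices off `A`. [folklore] -/
theorem plMap_indicator_eq_zero {s : Finset W} (hs : s ∈ K.faces) (hsA : Disjoint (s : Set W) A)
    {x : W} (hx : x ∈ convexHull ℝ (s : Set W)) : plMap K (A.indicator fun _ => (1 : ℝ)) x = 0 := by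
  classical
  obtain ⟨w, hw0, hw1, hwx⟩ := Finset.mem_convexHull'.1 hx
  rw [← hwx, plMap_sum_smul hs hw0 hw1]
  refine Finset.sum_eq_zero fun v hv => ?_
  rw [indicator_of_notMem (disjoint_left.1 hsA hv), smul_zero]

end Cutoff

/-! ### §2 The blend of a PL interpolation with a map along a PL cutoff -/

/-- **Blending a PL map with a continuous map along a PL cutoff.**  For a finite complex `K`,
vertex data `g`, a map `f` continuous on `|K|` and a set of vertices `A`, the map
`β x = λ x • plMap K g x + (1 - λ x) • f x`, `λ` the PL cutoff of `A`, is continuous on `|K|`,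
equals `plMap K g` on the closed simplices spanned in `A`, equals `f` on the closed simplices
spanned off `A`, equals `g` at the vertices in `A`, and satisfies `‖β x - f x‖ ≤ δ` wherever
`‖plMap K g x - f x‖ ≤ δ`. [cite: Rushing1973, proof of Thm. 1.6.10, Part 1 (relative
approximation)] -/
theorem exists_plBlend {K : Geometry.SimplicialComplex ℝ W} (hK : K.faces.Finite) (g : W → E)
    {f : W → E} (hf : ContinuousOn f K.space) (A : Set W) :
    ∃ β : W → E, ContinuousOn β K.space ∧
      (∀ s ∈ K.faces, (s : Set W) ⊆ A → EqOn β (plMap K g) (convexHull ℝ (s : Set W))) ∧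
      (∀ s ∈ K.faces, Disjoint (s : Set W) A → EqOn β f (convexHull ℝ (s : Set W))) ∧
      (∀ v ∈ K.vertices, v ∈ A → β v = g v) ∧
      ∀ (δ : ℝ) (x : W), x ∈ K.space → ‖plMap K g x - f x‖ ≤ δ → ‖β x - f x‖ ≤ δ := by
  set lam : W → ℝ := plMap K (A.indicator fun _ => (1 : ℝ)) with hlam
  refine ⟨fun x => lam x • plMap K g x + (1 - lam x) • f x, ?_, fun s hs hsA x hx => ?_,
    fun s hs hsA x hx => ?_, fun v hv hvA => ?_, fun δ x hx hδ => ?_⟩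
  · exact ((continuousOn_plMap hK _).smul (continuousOn_plMap hK g)).add
      ((continuousOn_const.sub (continuousOn_plMap hK _)).smul hf)
  · show lam x • plMap K g x + (1 - lam x) • f x = plMap K g x
    rw [hlam, plMap_indicator_eq_one A hs hsA hx, one_smul, sub_self, zero_smul, add_zero]
  · show lam x • plMap K g x + (1 - lam x) • f x = f x
    rw [hlam, plMap_indicator_eq_zero A hs hsA hx, zero_smul, sub_zero, one_smul, zero_add]
  · have hv' : ({v} : Finset W) ∈ K.faces := Geometry.SimplicialComplex.mem_vertices.1 hv
    have hvconv : v ∈ convexHull ℝ ((({v} : Finset W)) : Set W) :=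
      subset_convexHull ℝ _ (by simp)
    show lam v • plMap K g v + (1 - lam v) • f v = g v
    rw [hlam, plMap_indicator_eq_one A hv' (by simpa using hvA) hvconv, one_smul, sub_self,
      zero_smul, add_zero, plMap_apply_of_mem hv' (Finset.mem_singleton_self v)]
  · have hl := plMap_indicator_mem_Icc A hx
    have heq : lam x • plMap K g x + (1 - lam x) • f x - f x = lam x • (plMap K g x - f x) := by
      rw [smul_sub, sub_smul, one_smul]
      abel
    show ‖lam x • plMap K g x + (1 - lam x) • f x - f x‖ ≤ δ
    rw [heq, norm_smul, Real.norm_of_nonneg hl.1]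
    calc lam x * ‖plMap K g x - f x‖ ≤ 1 * ‖plMap K g x - f x‖ :=
          mul_le_mul_of_nonneg_right hl.2 (norm_nonneg _)
      _ ≤ δ := by rw [one_mul]; exact hδ

/-! ### §3 Relative PL approximation -/

/-- **Relative PL approximation of a continuous map on a finite complex** (Rushing, Thm. 1.6.10
Part 1 / Thm. 1.6.11, in the form used in the proof of Thm. 4.12.1 to pass from `α` to `β`).
Let `K` be a finite complex in a finite-dimensional real normed space, `f` continuous on `|K|`
with values in a real normed space, `Z ⊆ W` and `ε > 0`.  Then there is a finite refinement `P`
of `K` (same underlying space; each simplex of `P` in a simplex of `K`; each simplex of `K`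
covered by simplices of `P` inside it) such that for every vertex data `g` with
`‖g v - f v‖ ≤ ε / 2` at the vertices of `P` there is `β`, continuous on `|K|`, with
`‖β x - f x‖ ≤ ε` on `|K|`, `β = plMap P g` on each closed simplex of `P` spanned by vertices in
`Z`, `β = f` on each closed simplex of `P` with no vertex in `Z`, and `β v = g v` at the vertices
of `P` in `Z`.  (Choose `g = f` off the vertices to be perturbed and in general position on them,
`exists_relGenPos_plMap`, to obtain the general-position PL approximation of Fact 2.)
[cite: Rushing1973, Thm. 1.6.10 (Part 1), Thm. 1.6.11; proof of Thm. 4.12.1, Fact 2] -/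
theorem exists_plApprox (K : Geometry.SimplicialComplex ℝ W) (hK : K.faces.Finite) (Z : Set W)
    {f : W → E} (hf : ContinuousOn f K.space) {ε : ℝ} (hε : 0 < ε) :
    ∃ P : Geometry.SimplicialComplex ℝ W, P.faces.Finite ∧ P.space = K.space ∧
      (∀ t ∈ P.faces, ∃ s ∈ K.faces, convexHull ℝ (t : Set W) ⊆ convexHull ℝ (s : Set W)) ∧
      (∀ s ∈ K.faces, ∀ y ∈ convexHull ℝ (s : Set W), ∃ t ∈ P.faces,
        y ∈ convexHull ℝ (t : Set W) ∧ convexHull ℝ (t : Set W) ⊆ convexHull ℝ (s : Set W)) ∧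
      ∀ g : W → E, (∀ v ∈ P.vertices, ‖g v - f v‖ ≤ ε / 2) →
        ∃ β : W → E, ContinuousOn β K.space ∧ (∀ x ∈ K.space, ‖β x - f x‖ ≤ ε) ∧
          (∀ s ∈ P.faces, (s : Set W) ⊆ Z → EqOn β (plMap P g) (convexHull ℝ (s : Set W))) ∧
          (∀ s ∈ P.faces, Disjoint (s : Set W) Z → EqOn β f (convexHull ℝ (s : Set W))) ∧
          ∀ v ∈ P.vertices, v ∈ Z → β v = g v := by
  -- uniform continuity of `f` on the compact `|K|`
  have hKc : IsCompact K.space := isCompact_space_of_finite hK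
  have hε4 : 0 < ε / 4 := by positivity
  obtain ⟨δ, hδ, hδf⟩ : ∃ δ > 0, ∀ x ∈ K.space, ∀ y ∈ K.space, ‖x - y‖ ≤ δ → ‖f x - f y‖ ≤ ε / 4 := by
    have huc := hKc.uniformContinuousOn_of_continuous hf
    rw [Metric.uniformContinuousOn_iff] at huc
    obtain ⟨δ', hδ', h⟩ := huc (ε / 4) hε4
    refine ⟨δ' / 2, half_pos hδ', fun x hx y hy hxy => le_of_lt ?_⟩
    have : dist x y < δ' := by rw [dist_eq_norm]; linarith
    simpa [dist_eq_norm] using h x hx y hy this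
  -- the fine refinement
  obtain ⟨P, hPfin, hPsp, hPref, hPcov, hPosc⟩ := exists_refinement_oscillation_le K hK f hδ hδf
  refine ⟨P, hPfin, hPsp, hPref, hPcov, fun g hg => ?_⟩
  -- the blend on `P`
  have hfP : ContinuousOn f P.space := hPsp ▸ hf
  obtain ⟨β, hβc, hβZ, hβoff, hβv, hβest⟩ := exists_plBlend hPfin g hfP Z
  refine ⟨β, hPsp ▸ hβc, fun x hx => ?_, hβZ, hβoff, hβv⟩
  have hxP : x ∈ P.space := hPsp ▸ hx
  refine hβest ε x hxP ?_
  -- `‖plMap P g - f‖ ≤ ε / 2 + ε / 4 ≤ ε`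
  have h1 : ‖plMap P g x - plMap P f x‖ ≤ ε / 2 :=
    norm_plMap_sub_plMap_le (fun s hs v hv => hg v (Geometry.SimplicialComplex.mem_vertices.2
      (P.down_closed hs (Finset.singleton_subset_iff.2 hv) (Finset.singleton_nonempty v)))) hxP
  have h2 : ‖plMap P f x - f x‖ ≤ ε / 4 :=
    norm_plMap_sub_self_le (fun s hs y hy v hv => hPosc s hs v
      (subset_convexHull ℝ _ (by exact_mod_cast hv)) y hy) hxP
  calc ‖plMap P g x - f x‖ = ‖(plMap P g x - plMap P f x) + (plMap P f x - f x)‖ := by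
        rw [sub_add_sub_cancel]
    _ ≤ ‖plMap P g x - plMap P f x‖ + ‖plMap P f x - f x‖ := norm_add_le _ _
    _ ≤ ε := by linarith

end Literature.Topology.FourManifolds

end
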